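import Summits.CriticalPhenomena.SAWScalingLimit.Theses.SAWTrackTransport
import Summits.CriticalPhenomena.SAWScalingLimit.Theses.SAWParafermion
import Summits.CriticalPhenomena.SAWScalingLimit.Theorems.SAWDevelopingMapHexTransferCompassRealisation
import Summits.CriticalPhenomena.SAWScalingLimit.Theorems.SAWDevelopingMapHexTransferPortDictionary
import Summits.CriticalPhenomena.SAWScalingLimit.Theorems.SAWDevelopingMapHexTransferPortTransfer
import Summits.CriticalPhenomena.SAWScalingLimit.Theorems.SAWCompassLatticeSurfaceUniversalityNonVacuity
import Literature.Probability.RandomPlanarGeometry.SLEConvergenceCriterion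
import Literature.Probability.RandomPlanarGeometry.PortGadgetLattice
import Literature.Probability.RandomPlanarGeometry.DiagonalDressedSAW
import Literature.Probability.RandomPlanarGeometry.SelfAvoidingWalkProofs
import Mathlib.MeasureTheory.Measure.Portmanteau

/-!
# Birth skeleton for the crux `YBtoUniform` (stmt-CriticalPhenomena-16966, route SAWTrackTransport)

`YBtoUniform` (rank 6; the conjunct-facing "YB → uniform `ℤ²`" toll of the track-transport route):
for every Dobrushin domain `D`, every `δℤ²` endpoint approximation `(a_δ, b_δ)`
(`SAW.IsEndpointApprox`), every square-tiling Yang–Baxter endpoint approximation `(a'_δ, b'_δ)`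
(`IsYBEndpointApprox` at `Θ ≡ π/2`) and every bounded continuous `f` on `CurveClass ℂ`,
`∫ f∘curve dSAW.law(D)_δ − ∫ f∘curve d ybLaw(π/2)(D)_δ → 0` as `δ → 0⁺`.

The route files no mechanism of its own for this node ("same status and content as
`SAWCompassLattice.SurfaceUniversality`", stmt-CriticalPhenomena-6964), and that sibling crux
already carries a typed line — `Cruxes/SurfaceUniversality/Lines/lipschitz_toll.lean`
(crux-strategist, 2026-08-17) with its sorry-free companion `Cruxes/SurfaceUniversality/TightToll.lean`.
This skeleton is DELIBERATELY ALIGNED with that line, so that one proof closes a stub on both cruxes: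
its three stubs are, verbatim, the three stubs of `lipschitz_toll` (spelled out over tree
declarations), and everything between them and `YBtoUniform` is proved here.

THE CUT — determining class + one-sided precompactness, at Glazman–Manolescu's Yang–Baxter walk:

* `stub_tightZ2` (T; open, L–XL; SHARED BY NAME: the item stmt-CriticalPhenomena-1881
  `SAWParafermion.EventualTight`, wanted by 15 routes) — eventual tightness `IsTightAlongMesh` of
  the critical `δℤ²` SAW curve laws along `𝓝[>] 0` (the repaired, eventual form; NOT the all-`δ`
  `IsTightLaws` form refuted as stmt-CriticalPhenomena-0772).
* `stub_lipPlusPointIsZ2` (Z; M–XL; ONE model, no universality content; = `lipschitz_toll`'s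
  `LipPlusPointIsZ2`) — the critical `δℤ²` SAW law (`SAW.law`: sites, `discreteDomainGraph`,
  endpoints `a_δ, b_δ`) and the critical PLUS-LATTICE law (uniform SAW on the face centres of
  `meshFaces (π/2) Ω δ`, one centre per face wired to its four ports, half-edge fugacity `√x_c`;
  port endpoints `a'_δ, b'_δ`) merge on bounded LIPSCHITZ test functions: conventions (half-mesh
  shift, ports-vs-centres polyline: `≤ δ`, free at Lipschitz level) + boundary-layer / endpoint
  locality of ONE model's chordal law in bounded-Lipschitz distance.
* `stub_lipPlusToYB` (K; XL, open — THE KERNEL; = `lipschitz_toll`'s `LipPlusToYB`) — on the SAME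
  faces, ports and endpoints, the critical plus law (GM face weights `(u, v, w) = (x_c, x_c, 0)`)
  and GM's critical Yang–Baxter law `ybLaw (π/2) Ω δ 1 a' b'` (`(u₁, v, w₁)(π/2) =
  (0.4084, 0.3209, 0.1127)`, drawn by `YBWalk.curve`) merge on bounded Lipschitz test functions —
  planar SAW universality between the uniform and the integrable `n = 0` point of the square
  lattice with topology (tightness) and conventions factored out; equivalently the Dudley distance
  of the two curve laws `→ 0`.

PROVED HERE (no `sorry`): `lipYBtoUniform_of_stubs` (Z + K ⇒ `LipYBtoUniform`, the crux on bounded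
Lipschitz functions, by addition); `eventually_isProbabilityMeasure_ybLaw` (NEW: under a port
endpoint approximation GM's law `ybLaw (π/2) D δ 1 a'_δ b'_δ` is a probability measure for all
small `δ > 0` — through the LANDED compass realisation `Sketch.stub_compassRealisation`
(stmt-6963), port dictionary `Sketch.stub_portDictionary` (stmt-6966), push-forward identities
`PortTransfer.compassLaw_eq_map` / `PortTransfer.ybLaw_eq_map` and
`Surface.eventually_isProbabilityMeasure_compassLaw_of_isCompassSolution`);
`tendsto_sub_of_isTightAlongMesh` (the ONE-SIDED Prokhorov upgrade on the Polish space
`CurveClass ℂ`, copied verbatim from `TightToll.lean` — credit planner-cstrat-stmt-CriticalPhenomena-6964-s1: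
subsequence principle + `IsTightAlongMesh.exists_subseq` + Mathlib's bounded-Lipschitz portmanteau;
the tightness of the YB side is never needed); `ybToUniform_of_tight_of_lip :
SAWParafermion.EventualTight → LipYBtoUniform → SAWTrackTransport.YBtoUniform` (16966 ⇐ 1881 ∧
Lip-16966 — the exact analogue for this crux of `TightToll.surfaceUniversality_of_tight_of_lipYBtoUniform`);
and the registered composition `YBtoUniform_of : T → Z → K → SAWTrackTransport.YBtoUniform`.

Why the Lipschitz/`C_b` cut is a genuine cut: for finitely supported laws with no precompactness,
merging on `C_b(CurveClass ℂ)` can FAIL while bounded-Lipschitz merging holds (separate the two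
supports along a mesh sequence by a Tietze extension on a closed discrete set), so
`YBtoUniform ⇔ LipYBtoUniform` only GIVEN T; both T and Z + K are load-bearing in `YBtoUniform_of`.

Disproof used: none — the crux has no `Disproof.lean` / `Negative/` lemmas at registration
(`ledger crux ls stmt-CriticalPhenomena-16966`: no workfiles). Negatives index honoured: stmt-0772
(all-`δ` tightness of the `δℤ²` SAW) is not used — T is its repaired eventual form stmt-1881.
An earlier draft of this skeleton (compass intermediate; stubs `portCouplingBL`, `testClassUpgrade`
now known to be PROVED in `TightToll.lean`) is kept in the planner folder as `bc/YBtoUniform_birth_v1_compass.lean`.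
-/

noncomputable section

namespace Summit.CriticalPhenomena.SAWScalingLimit.Cruxes.YBtoUniform.Birth

open MeasureTheory Filter Topology Set
open scoped NNReal ENNReal BoundedContinuousFunction
open Literature.Probability.RandomPlanarGeometry
open Literature.Probability.RandomPlanarGeometry.SAW
open Literature.Probability.RandomPlanarGeometry.SAW.YangBaxter
open Literature.Probability.LatticeModels (Site)
open Summit.CriticalPhenomena.SAWScalingLimit.Theses
open Summit.CriticalPhenomena.SAWScalingLimit.Cruxes.HexTransfer.Sketch

/-! ### Generic: one-sided tightness upgrades bounded-Lipschitz merging to `C_b` merging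
(verbatim from `Cruxes/SurfaceUniversality/TightToll.lean`, sorry-free there and here) -/

section Generic

variable {Ω : ℝ → Type*} [∀ δ, MeasurableSpace (Ω δ)]

/-- **One-sided Prokhorov upgrade.** Let `Y δ : Ω δ → CurveClass ℂ` be random curve classes under
laws `P δ` (probability measures making `Y δ` a.e.-measurable for small `δ`) forming a TIGHT family
along `δ → 0⁺`, and let `ν δ` be probability measures on `CurveClass ℂ` for small `δ` (NO tightness
assumed). If `E[g(Y δ)] − ∫ g dν δ → 0` for every bounded Lipschitz `g`, then
`E[f(Y δ)] − ∫ f dν δ → 0` for every bounded continuous `f`. Proof: by the subsequence principle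
it suffices to extract, from every sequence of meshes `s n → 0⁺`, a subsequence along which the
difference tends to `0`; Prokhorov along the mesh gives a subsequence with `Y ⇒ μ`; then `ν ⇒ μ`
on bounded Lipschitz functions, hence weakly (bounded-Lipschitz portmanteau), hence on `f`.
(Copied from `TightToll.tendsto_sub_of_isTightAlongMesh`.)
[cite: BillingsleyCPM1999, Thm. 5.1 and Thm. 2.6] -/
theorem tendsto_sub_of_isTightAlongMesh {Y : ∀ δ, Ω δ → CurveClass ℂ} {P : ∀ δ, Measure (Ω δ)}
    {ν : ℝ → Measure (CurveClass ℂ)}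
    (hP : ∀ᶠ δ in 𝓝[>] (0 : ℝ), IsProbabilityMeasure (P δ))
    (hY : ∀ᶠ δ in 𝓝[>] (0 : ℝ), AEMeasurable (Y δ) (P δ))
    (hT : IsTightAlongMesh Y P)
    (hν : ∀ᶠ δ in 𝓝[>] (0 : ℝ), IsProbabilityMeasure (ν δ))
    (hLip : ∀ (g : CurveClass ℂ →ᵇ ℝ) (L : ℝ≥0), LipschitzWith L g →
      Tendsto (fun δ => (∫ ω, g (Y δ ω) ∂P δ) - ∫ x, g x ∂ν δ) (𝓝[>] (0 : ℝ)) (𝓝 0))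
    (f : CurveClass ℂ →ᵇ ℝ) :
    Tendsto (fun δ => (∫ ω, f (Y δ ω) ∂P δ) - ∫ x, f x ∂ν δ) (𝓝[>] (0 : ℝ)) (𝓝 0) := by
  classical
  -- surrogate probability laws on the curve space, equal to the push-forward laws for small `δ`
  obtain ⟨ρ, hρ⟩ : ∃ ρ : ℝ → Measure (CurveClass ℂ), ∀ δ, ρ δ =
      if IsProbabilityMeasure ((P δ).map (Y δ)) then (P δ).map (Y δ)
      else Measure.dirac (CurveClass.mk (Curve.const 0)) :=
    ⟨_, fun _ => rfl⟩
  have hρprob : ∀ δ, IsProbabilityMeasure (ρ δ) := by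
    intro δ
    by_cases h : IsProbabilityMeasure ((P δ).map (Y δ))
    · rw [hρ δ, if_pos h]
      exact h
    · rw [hρ δ, if_neg h]
      infer_instance
  have hev : ∀ᶠ δ in 𝓝[>] (0 : ℝ), AEMeasurable (Y δ) (P δ) ∧ ρ δ = (P δ).map (Y δ) := by
    filter_upwards [hP, hY] with δ hPδ hYδ
    haveI := hPδ
    refine ⟨hYδ, ?_⟩
    rw [hρ δ, if_pos (Measure.isProbabilityMeasure_map hYδ)]
  have hTρ : IsTightAlongMesh (Ωδ := fun _ : ℝ => CurveClass ℂ)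
      (fun (_ : ℝ) (x : CurveClass ℂ) => x) ρ := by
    intro ε hε
    obtain ⟨K, hK, hb⟩ := hT ε hε
    refine ⟨K, hK, ?_⟩
    filter_upwards [hb, hev] with δ hδ hδ'
    have hpre : (fun x : CurveClass ℂ => x) ⁻¹' Kᶜ = Kᶜ := rfl
    rw [hpre, hδ'.2,
      Measure.map_apply_of_aemeasurable hδ'.1 hK.isClosed.isOpen_compl.measurableSet]
    exact hδ
  haveI : ∀ δ, IsProbabilityMeasure (ρ δ) := hρprob
  refine tendsto_of_subseq_tendsto fun s hs => ?_
  obtain ⟨φ, μ, hφ, hμ, hlim⟩ :=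
    hTρ.exists_subseq (Filter.Eventually.of_forall fun δ => aemeasurable_id') hs
  refine ⟨φ, ?_⟩
  have ht : Tendsto (fun n => s (φ n)) atTop (𝓝[>] (0 : ℝ)) := hs.comp hφ.tendsto_atTop
  -- (i) the tight side converges to `μ` along `s ∘ φ`, on every bounded continuous function
  have hA : ∀ g : CurveClass ℂ →ᵇ ℝ,
      Tendsto (fun n => ∫ ω, g (Y (s (φ n)) ω) ∂P (s (φ n))) atTop (𝓝 (∫ x, g x ∂μ)) := by
    intro g
    refine (hlim g).congr' ?_
    filter_upwards [ht.eventually hev] with n hn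
    change ∫ x, g x ∂ρ (s (φ n)) = _
    rw [hn.2, integral_map hn.1 g.continuous.aestronglyMeasurable]
  -- (ii) the other side converges to `μ` along `s ∘ φ`, on bounded Lipschitz functions
  have hB : ∀ (g : CurveClass ℂ →ᵇ ℝ) (L : ℝ≥0), LipschitzWith L g →
      Tendsto (fun n => ∫ x, g x ∂ν (s (φ n))) atTop (𝓝 (∫ x, g x ∂μ)) := by
    intro g L hL
    have h1 : Tendsto (fun n => (∫ ω, g (Y (s (φ n)) ω) ∂P (s (φ n))) - ∫ x, g x ∂ν (s (φ n)))
        atTop (𝓝 0) := (hLip g L hL).comp ht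
    have h2 := (hA g).sub h1
    rw [sub_zero] at h2
    exact h2.congr fun n => sub_sub_cancel _ _
  -- (iii) surrogate probability measures on the `ν` side; bounded-Lipschitz portmanteau
  let ν' : ℕ → ProbabilityMeasure (CurveClass ℂ) := fun n =>
    if h : IsProbabilityMeasure (ν (s (φ n))) then ⟨ν (s (φ n)), h⟩ else ⟨μ, hμ⟩
  have hν' : ∀ᶠ n in atTop, ((ν' n : ProbabilityMeasure (CurveClass ℂ)) : Measure (CurveClass ℂ))
      = ν (s (φ n)) := by
    filter_upwards [ht.eventually hν] with n hn
    show ((if h : IsProbabilityMeasure (ν (s (φ n))) then (⟨ν (s (φ n)), h⟩ : ProbabilityMeasure _)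
      else ⟨μ, hμ⟩ : ProbabilityMeasure (CurveClass ℂ)) : Measure (CurveClass ℂ)) = _
    rw [dif_pos hn]
    rfl
  have hweak : Tendsto ν' atTop (𝓝 (⟨μ, hμ⟩ : ProbabilityMeasure (CurveClass ℂ))) := by
    refine tendsto_iff_forall_lipschitz_integral_tendsto.2 fun g hgb hgl => ?_
    obtain ⟨L, hL⟩ := hgl
    let gb : CurveClass ℂ →ᵇ ℝ := ⟨⟨g, hL.continuous⟩, hgb⟩
    refine ((hB gb L hL).congr' ?_)
    filter_upwards [hν'] with n hn
    rw [hn]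
    rfl
  -- (iv) hence on `f`, and the difference tends to `∫ f dμ - ∫ f dμ = 0`
  have hC : Tendsto (fun n => ∫ x, f x ∂ν (s (φ n))) atTop (𝓝 (∫ x, f x ∂μ)) := by
    have h := (ProbabilityMeasure.tendsto_iff_forall_integral_tendsto.1 hweak) f
    refine h.congr' ?_
    filter_upwards [hν'] with n hn
    rw [hn]
  have h := (hA f).sub hC
  rwa [sub_self] at h

end Generic

/-! ### The two laws are eventually probability measures (sorry-free) -/

/-- **Under an endpoint approximation the critical `δℤ²` SAW law of `(Ω_δ; a_δ, b_δ)` is a probability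
measure for all small `δ > 0`**: the endpoints are joined in `Ω_δ` (a SAW exists; `x_c > 0`,
`SAW.criticalFugacity_pos_lt_one'`) and `Ω_δ` is finite (`SAW.finite_domainSAW`, so the partition
function is finite). Re-proved here from Literature lemmas only (the same fact is landed in other
routes' theorem files, e.g. `SubseqIdentification.Negative.eventually_isProbabilityMeasure_law`), to
keep this workfile's import cone inside routes SAWTrackTransport / SAWParafermion / SAWCompassLattice.
[folklore] -/
theorem eventually_isProbabilityMeasure_sawLaw {D : DobrushinDomain} {a b : ℝ → Site 2}
    (h : SAW.IsEndpointApprox D a b) :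
    ∀ᶠ δ in 𝓝[>] (0 : ℝ), IsProbabilityMeasure (SAW.law D.carrier δ (a δ) (b δ)) := by
  classical
  filter_upwards [h.reachable, self_mem_nhdsWithin] with δ hr hδ
  haveI := SAW.finite_domainSAW D.isBounded (Set.mem_Ioi.1 hδ) (a δ) (b δ)
  haveI : Fintype (SAW.DomainSAW D.carrier δ (a δ) (b δ)) := Fintype.ofFinite _
  obtain ⟨p⟩ := hr
  let γ₀ : SAW.DomainSAW D.carrier δ (a δ) (b δ) := ⟨p.toPath, p.toPath.2⟩
  have htop : SAW.weight D.carrier δ (a δ) (b δ) Set.univ ≠ ⊤ := by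
    rw [SAW.weight, Measure.sum_apply _ MeasurableSet.univ, tsum_fintype]
    exact ENNReal.sum_ne_top.2 fun γ _ => by simp
  have h0 : SAW.weight D.carrier δ (a δ) (b δ) Set.univ ≠ 0 := by
    intro h0
    have h1 : SAW.weight D.carrier δ (a δ) (b δ) {γ₀} ≤ SAW.weight D.carrier δ (a δ) (b δ) Set.univ :=
      measure_mono (Set.subset_univ _)
    rw [h0, SAW.weight_singleton, nonpos_iff_eq_zero, ENNReal.ofReal_eq_zero] at h1
    exact absurd h1 (not_le.2 (pow_pos SAW.criticalFugacity_pos_lt_one'.1 _))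
  exact ⟨by rw [SAW.law, Measure.smul_apply, smul_eq_mul, ENNReal.inv_mul_cancel h0 htop]⟩

/-! ### GM's square-tiling law is eventually a probability measure (NEW, sorry-free) -/

/-- **Under a port endpoint approximation, Glazman–Manolescu's critical square-tiling law
`ybLaw (π/2) D δ 1 a'_δ b'_δ` is a probability measure for all small `δ > 0`.** Proof through the
compass lattice, all inputs LANDED: a solution `(α, β, s, z)` of the compass equations exists
(`Sketch.stub_compassRealisation`, item stmt-6963); the compass chordal law is eventually a
probability measure (`Surface.eventually_isProbabilityMeasure_compassLaw_of_isCompassSolution`);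
the compass law and GM's law are push-forwards of ONE normalised path measure `ρ_δ`
(`PortTransfer.compassLaw_eq_map`; `PortTransfer.ybLaw_eq_map` through the port dictionary
`Sketch.stub_portDictionary`, item stmt-6966), so both have total mass `ρ_δ(univ)`. [folklore] -/
theorem eventually_isProbabilityMeasure_ybLaw (D : DobrushinDomain) {a' b' : ℝ → MidEdge}
    (h : IsYBEndpointApprox (fun (_ : ℤ) => Real.pi / 2) D a' b') :
    ∀ᶠ δ in 𝓝[>] (0 : ℝ),
      IsProbabilityMeasure (ybLaw (fun (_ : ℤ) => Real.pi / 2) D.carrier δ 1 (a' δ) (b' δ)) := by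
  obtain ⟨α, β, s, z, hsol⟩ :=
    Summit.CriticalPhenomena.SAWScalingLimit.Cruxes.HexTransfer.Sketch.stub_compassRealisation
  have hsol' : IsCompassSolution α β s z := (isCompassSolution_iff α β s z).2 hsol
  have hP : SAWCompassLattice.PortDictionary :=
    Summit.CriticalPhenomena.SAWScalingLimit.Cruxes.HexTransfer.Sketch.stub_portDictionary
  filter_upwards [Surface.eventually_isProbabilityMeasure_compassLaw_of_isCompassSolution hsol' D h]
    with δ hδ
  -- total mass of the normalised compass path measure is `1`
  have h1 : PortTransfer.compassRho α β s z D.carrier δ (a' δ) (b' δ) Set.univ = 1 := by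
    have hm := hδ.measure_univ
    change PortTransfer.compassLaw α β s z D.carrier δ (a' δ) (b' δ) Set.univ = 1 at hm
    rwa [PortTransfer.compassLaw_eq_map,
      Measure.map_apply (PortTransfer.measurable_cpath _) MeasurableSet.univ, Set.preimage_univ] at hm
  refine ⟨?_⟩
  rw [PortTransfer.ybLaw_eq_map hP hsol,
    Measure.map_apply (PortTransfer.measurable_cpath _) MeasurableSet.univ, Set.preimage_univ]
  exact h1

/-! ### The statements of the line (verbatim `Cruxes/SurfaceUniversality/Lines/lipschitz_toll.lean`) -/

/-- **The critical plus-lattice chordal law** of `Ω_δ` from port `a` to port `b`: self-avoiding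
port–centre–port–…–port paths of the plus lattice (one centre per face of the square tiling, wired
to its four ports; `walkWeight_plusFugacity : weight = p ^ length`) whose centres are faces of
`meshFaces (π/2) Ω δ`, at the critical half-edge fugacity `p = √x_c` (a visited centre costs
`x_c = SAW.criticalFugacity`), normalised and pushed to `CurveClass ℂ` by the rescaled polyline
through ports and centres: the critical `ℤ²` SAW on the face centres `δ(ℤ² + (1+i)/2)` between the
faces of the end ports — the `(u, v, w) = (x_c, x_c, 0)` point of GM's face-weight family, on the
SAME faces and ports as `ybLaw (π/2)`. (Verbatim `LipschitzToll.plusLaw`.) [folklore] -/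
def plusLaw (Ω : Set ℂ) (δ : ℝ) (a b : MidEdge) : Measure (CurveClass ℂ) :=
  PortGadget.pathLaw plusLattice (plusFugacity (Real.sqrt SAW.criticalFugacity))
    (PortGadget.embed plusPos) (PortGadget.inFaces (meshFaces rightAngles Ω δ)) δ
    (Sum.inl a) (Sum.inl b)

/-- **(Z) The plus point is `ℤ²`, at bounded-Lipschitz level** (`ℤ²` only; verbatim
`LipschitzToll.LipPlusPointIsZ2`): for every Dobrushin domain, every `ℤ²` endpoint approximation
`(a, b)` and every port endpoint approximation `(a', b')` at `Θ ≡ π/2`, the critical `δℤ²` SAW law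
and the critical plus-lattice law between the ports merge on bounded LIPSCHITZ test functions.
[cite: LawlerSchrammWerner2004SAW, §3.4.2 (independence of the lattice approximation of domain
and endpoints, conjectural)] -/
def LipPlusPointIsZ2 : Prop :=
  ∀ (D : DobrushinDomain) (a b : ℝ → Site 2) (a' b' : ℝ → MidEdge),
    SAW.IsEndpointApprox D a b → IsYBEndpointApprox rightAngles D a' b' →
    ∀ (f : BoundedContinuousFunction (CurveClass ℂ) ℝ) (L : ℝ≥0), LipschitzWith L f →
      Tendsto (fun δ : ℝ => (∫ γ, f γ.curve ∂(SAW.law D.carrier δ (a δ) (b δ))) -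
          ∫ x, f x ∂(plusLaw D.carrier δ (a' δ) (b' δ))) (𝓝[>] (0 : ℝ)) (𝓝 0)

/-- **(K) THE KERNEL: plus point vs Yang–Baxter point, at bounded-Lipschitz level** (verbatim
`LipschitzToll.LipPlusToYB`): for every Dobrushin domain and every port endpoint approximation at
`Θ ≡ π/2`, the critical plus-lattice law and GM's critical Yang–Baxter law on the square tiling —
SAME faces, SAME ports, SAME endpoints — merge on bounded Lipschitz test functions (their Dudley
distance tends to `0`). [cite: GlazmanManolescu2019, §1 and Thm. 3 (the integrable square-lattice
walk; scalar universality only)] [cite: Beffara2008Universal, §1–2] -/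
def LipPlusToYB : Prop :=
  ∀ (D : DobrushinDomain) (a' b' : ℝ → MidEdge), IsYBEndpointApprox rightAngles D a' b' →
    ∀ (f : BoundedContinuousFunction (CurveClass ℂ) ℝ) (L : ℝ≥0), LipschitzWith L f →
      Tendsto (fun δ : ℝ => (∫ x, f x ∂(plusLaw D.carrier δ (a' δ) (b' δ))) -
          ∫ γ, f (γ.curve rightAngles δ) ∂(ybLaw rightAngles D.carrier δ 1 (a' δ) (b' δ)))
        (𝓝[>] (0 : ℝ)) (𝓝 0)

/-- **The crux on bounded Lipschitz test functions** (verbatim `LipschitzToll.LipYBtoUniform` /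
`TightToll.LipYBtoUniform`): `SAWTrackTransport.YBtoUniform` with `f` restricted to bounded
Lipschitz functions. [folklore] -/
def LipYBtoUniform : Prop :=
  ∀ (D : DobrushinDomain) (a b : ℝ → Site 2) (a' b' : ℝ → MidEdge),
    SAW.IsEndpointApprox D a b → IsYBEndpointApprox rightAngles D a' b' →
    ∀ (f : BoundedContinuousFunction (CurveClass ℂ) ℝ) (L : ℝ≥0), LipschitzWith L f →
      Tendsto (fun δ : ℝ => (∫ γ, f γ.curve ∂(SAW.law D.carrier δ (a δ) (b δ))) -
          ∫ γ, f (γ.curve rightAngles δ) ∂(ybLaw rightAngles D.carrier δ 1 (a' δ) (b' δ)))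
        (𝓝[>] (0 : ℝ)) (𝓝 0)

/-! ### Registered stubs (T, Z, K — the stubs of `lipschitz_toll`, spelled out over tree declarations) -/

/-- Stub T (L–XL, open; SHARED BY NAME: the item stmt-CriticalPhenomena-1881
`SAWParafermion.EventualTight`, wanted by 15 routes; implied by the `(0, δ₀]`-form stmt-1372 via
`isTightAlongMesh_of_isTightMeasureSet_image`): **eventual tightness of the critical `δℤ²` SAW curve
laws** along the mesh filter. Why open: no RSW / annulus-crossing technology at `x = x_c` for the
self-avoiding walk (Kemppainen–Smirnov 2017 Condition G2 not in print for SAW; available inputs: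
sub-ballisticity, Duminil-Copin–Hammond 2013; bridge decay). The only `C_b`-strength input of the
line; necessary in kind for the summit along sequences. Identical to `LipschitzToll.stub_tightZ2`. -/
theorem stub_tightZ2 : SAWParafermion.EventualTight := by
  sorry

/-- Stub Z (M–XL; `ℤ²` only) = `LipPlusPointIsZ2` spelled out (`plusLaw` unfolded): the plus point
is `ℤ²` at bounded-Lipschitz level — conventions (half-mesh translation, polyline through
ports-and-centres vs centres: `≤ δ`, free for Lipschitz `f`) + insensitivity in bounded-Lipschitz
distance of the critical chordal `ℤ²` law to the `O(δ)` boundary layer (`discreteDomainGraph` vs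
faces of `meshFaces`) and to an `o(1)` displacement of the boundary endpoints. Why it might fail as
typed: a convention slip between `SAW.law`'s largest-component discretisation and `meshFaces`, or
genuine boundary sensitivity of the critical chordal law near the marked prime ends (corridor
pinning); tools: Hammersley–Whittington corridor gap, Kesten patterns, DGHM endpoint delocalisation
(arXiv:1305.1257). Identical to `LipschitzToll.stub_lipPlusPointIsZ2`. -/
theorem stub_lipPlusPointIsZ2 :
    ∀ (D : DobrushinDomain) (a b : ℝ → Site 2) (a' b' : ℝ → MidEdge),
      SAW.IsEndpointApprox D a b → IsYBEndpointApprox rightAngles D a' b' →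
      ∀ (f : BoundedContinuousFunction (CurveClass ℂ) ℝ) (L : ℝ≥0), LipschitzWith L f →
        Tendsto (fun δ : ℝ => (∫ γ, f γ.curve ∂(SAW.law D.carrier δ (a δ) (b δ))) -
            ∫ x, f x ∂(PortGadget.pathLaw plusLattice (plusFugacity (Real.sqrt SAW.criticalFugacity))
              (PortGadget.embed plusPos) (PortGadget.inFaces (meshFaces rightAngles D.carrier δ)) δ
              (Sum.inl (a' δ)) (Sum.inl (b' δ)))) (𝓝[>] (0 : ℝ)) (𝓝 0) := by
  sorry

/-- Stub K (XL, open; HARDEST — the universality kernel) = `LipPlusToYB` spelled out: plus point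
`(x_c, x_c, 0)` vs Yang–Baxter point `(u₁, v, w₁)(π/2)` of GM's face-weight family on ONE scaffold
(same faces, ports, endpoints), at bounded-Lipschitz level. Why it might fail: no tool proves
irrelevance of the stiffness bias `v/u : 1 → 0.786` and the osculation weight `w/u² : 0 → 0.676` at
a non-Gaussian fixed point; a collapse / Blöte–Nienhuis branch transition along the interpolation
would separate the laws (only expected at `w/u² ≫ 1`). Identical to `LipschitzToll.stub_lipPlusToYB`. -/
theorem stub_lipPlusToYB :
    ∀ (D : DobrushinDomain) (a' b' : ℝ → MidEdge), IsYBEndpointApprox rightAngles D a' b' →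
      ∀ (f : BoundedContinuousFunction (CurveClass ℂ) ℝ) (L : ℝ≥0), LipschitzWith L f →
        Tendsto (fun δ : ℝ => (∫ x, f x ∂(PortGadget.pathLaw plusLattice
              (plusFugacity (Real.sqrt SAW.criticalFugacity)) (PortGadget.embed plusPos)
              (PortGadget.inFaces (meshFaces rightAngles D.carrier δ)) δ
              (Sum.inl (a' δ)) (Sum.inl (b' δ)))) -
            ∫ γ, f (γ.curve rightAngles δ) ∂(ybLaw rightAngles D.carrier δ 1 (a' δ) (b' δ)))
          (𝓝[>] (0 : ℝ)) (𝓝 0) := by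
  sorry

/-! ### Composition (sorry-free) -/

/-- The spelled-out stub Z is the named statement (by `rfl`). [folklore] -/
theorem lipPlusPointIsZ2_iff :
    LipPlusPointIsZ2 ↔
    ∀ (D : DobrushinDomain) (a b : ℝ → Site 2) (a' b' : ℝ → MidEdge),
      SAW.IsEndpointApprox D a b → IsYBEndpointApprox rightAngles D a' b' →
      ∀ (f : BoundedContinuousFunction (CurveClass ℂ) ℝ) (L : ℝ≥0), LipschitzWith L f →
        Tendsto (fun δ : ℝ => (∫ γ, f γ.curve ∂(SAW.law D.carrier δ (a δ) (b δ))) -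
            ∫ x, f x ∂(PortGadget.pathLaw plusLattice (plusFugacity (Real.sqrt SAW.criticalFugacity))
              (PortGadget.embed plusPos) (PortGadget.inFaces (meshFaces rightAngles D.carrier δ)) δ
              (Sum.inl (a' δ)) (Sum.inl (b' δ)))) (𝓝[>] (0 : ℝ)) (𝓝 0) :=
  Iff.rfl

/-- The spelled-out stub K is the named statement (by `rfl`). [folklore] -/
theorem lipPlusToYB_iff :
    LipPlusToYB ↔
    ∀ (D : DobrushinDomain) (a' b' : ℝ → MidEdge), IsYBEndpointApprox rightAngles D a' b' →
      ∀ (f : BoundedContinuousFunction (CurveClass ℂ) ℝ) (L : ℝ≥0), LipschitzWith L f →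
        Tendsto (fun δ : ℝ => (∫ x, f x ∂(PortGadget.pathLaw plusLattice
              (plusFugacity (Real.sqrt SAW.criticalFugacity)) (PortGadget.embed plusPos)
              (PortGadget.inFaces (meshFaces rightAngles D.carrier δ)) δ
              (Sum.inl (a' δ)) (Sum.inl (b' δ)))) -
            ∫ γ, f (γ.curve rightAngles δ) ∂(ybLaw rightAngles D.carrier δ 1 (a' δ) (b' δ)))
          (𝓝[>] (0 : ℝ)) (𝓝 0) :=
  Iff.rfl

/-- **Z + K give the crux on bounded Lipschitz functions** (add the two merging statements:
`(∫dP^{ℤ²} − ∫dPlus) + (∫dPlus − ∫dYB) = ∫dP^{ℤ²} − ∫dYB`). Verbatim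
`LipschitzToll.lipYBtoUniform_of_stubs`. [folklore] -/
theorem lipYBtoUniform_of_stubs (hZ : LipPlusPointIsZ2) (hK : LipPlusToYB) : LipYBtoUniform := by
  intro D a b a' b' hab hab' f L hf
  have h := (hZ D a b a' b' hab hab' f L hf).add (hK D a' b' hab' f L hf)
  rw [add_zero] at h
  exact h.congr fun δ => sub_add_sub_cancel _ _ _

/-- **16966 ⇐ 1881 ∧ Lip-16966.** Eventual tightness of the `ℤ²` side (`SAWParafermion.EventualTight`,
stmt-1881) upgrades the bounded-Lipschitz toll `LipYBtoUniform` to the `C_b` toll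
`SAWTrackTransport.YBtoUniform` (stmt-16966): the one-sided Prokhorov upgrade
`tendsto_sub_of_isTightAlongMesh` with the `ℤ²` side as the tight family (`SAW.law` is eventually a
probability measure, `eventually_isProbabilityMeasure_sawLaw`; the curve
observable is measurable) and GM's curve laws `ybLaw (π/2) ∘ curve⁻¹` as the second family
(eventually probability measures, `eventually_isProbabilityMeasure_ybLaw`; NO tightness of GM's walk
is used). [folklore] -/
theorem ybToUniform_of_tight_of_lip (hT : SAWParafermion.EventualTight) (hU : LipYBtoUniform) :
    SAWTrackTransport.YBtoUniform := by
  intro D a b a' b' hab hab' f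
  -- the YB integrals as integrals against the push-forward curve laws
  have hint : ∀ (g : CurveClass ℂ →ᵇ ℝ) (δ : ℝ),
      ∫ x, g x ∂((ybLaw (fun (_ : ℤ) => Real.pi / 2) D.carrier δ 1 (a' δ) (b' δ)).map
          (fun γ => γ.curve (fun (_ : ℤ) => Real.pi / 2) δ)) =
        ∫ γ, g (γ.curve (fun (_ : ℤ) => Real.pi / 2) δ)
          ∂(ybLaw (fun (_ : ℤ) => Real.pi / 2) D.carrier δ 1 (a' δ) (b' δ)) :=
    fun g δ => integral_map (YBWalk.measurable_of_top _).aemeasurable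
      g.continuous.aestronglyMeasurable
  have hνprob : ∀ᶠ δ in 𝓝[>] (0 : ℝ), IsProbabilityMeasure
      ((ybLaw (fun (_ : ℤ) => Real.pi / 2) D.carrier δ 1 (a' δ) (b' δ)).map
        (fun γ => γ.curve (fun (_ : ℤ) => Real.pi / 2) δ)) := by
    filter_upwards [eventually_isProbabilityMeasure_ybLaw D hab'] with δ hδ
    exact Measure.isProbabilityMeasure_map (YBWalk.measurable_of_top _).aemeasurable
  have key := tendsto_sub_of_isTightAlongMesh
    (ν := fun δ => (ybLaw (fun (_ : ℤ) => Real.pi / 2) D.carrier δ 1 (a' δ) (b' δ)).map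
      (fun γ => γ.curve (fun (_ : ℤ) => Real.pi / 2) δ))
    (eventually_isProbabilityMeasure_sawLaw hab)
    (Filter.Eventually.of_forall fun δ => SAW.aemeasurable_curve D.carrier δ (a δ) (b δ))
    (hT D a b hab) hνprob
    (fun g L hg => by
      simp only [hint]
      exact hU D a b a' b' hab hab' g L hg) f
  simp only [hint] at key
  exact key

/-- Conversely (trivially) the `C_b` toll gives its Lipschitz restriction, so GIVEN T the crux and
`LipYBtoUniform` are equivalent. (Verbatim `LipschitzToll.lipYBtoUniform_of_ybToUniform`.) [folklore] -/
theorem lipYBtoUniform_of_ybToUniform (h : SAWTrackTransport.YBtoUniform) : LipYBtoUniform :=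
  fun D a b a' b' hab hab' f _ _ => h D a b a' b' hab hab' f

/-- Given eventual `ℤ²` tightness, the crux is EQUIVALENT to its bounded-Lipschitz restriction. [folklore] -/
theorem ybToUniform_iff_lip_of_tight (hT : SAWParafermion.EventualTight) :
    SAWTrackTransport.YBtoUniform ↔ LipYBtoUniform :=
  ⟨lipYBtoUniform_of_ybToUniform, ybToUniform_of_tight_of_lip hT⟩

/-- **The registered composition** `YBtoUniform_of`: the three stub SIGNATURES (T by name = item
stmt-1881; Z and K spelled out) imply the crux `SAWTrackTransport.YBtoUniform` BY NAME. Real proof,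
no `sorry`: Z + K ⇒ `LipYBtoUniform` (addition), then T upgrades it (one-sided Prokhorov). -/
theorem YBtoUniform_of :
    SAWParafermion.EventualTight →
    (∀ (D : DobrushinDomain) (a b : ℝ → Site 2) (a' b' : ℝ → MidEdge),
      SAW.IsEndpointApprox D a b → IsYBEndpointApprox rightAngles D a' b' →
      ∀ (f : BoundedContinuousFunction (CurveClass ℂ) ℝ) (L : ℝ≥0), LipschitzWith L f →
        Tendsto (fun δ : ℝ => (∫ γ, f γ.curve ∂(SAW.law D.carrier δ (a δ) (b δ))) -
            ∫ x, f x ∂(PortGadget.pathLaw plusLattice (plusFugacity (Real.sqrt SAW.criticalFugacity))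
              (PortGadget.embed plusPos) (PortGadget.inFaces (meshFaces rightAngles D.carrier δ)) δ
              (Sum.inl (a' δ)) (Sum.inl (b' δ)))) (𝓝[>] (0 : ℝ)) (𝓝 0)) →
    (∀ (D : DobrushinDomain) (a' b' : ℝ → MidEdge), IsYBEndpointApprox rightAngles D a' b' →
      ∀ (f : BoundedContinuousFunction (CurveClass ℂ) ℝ) (L : ℝ≥0), LipschitzWith L f →
        Tendsto (fun δ : ℝ => (∫ x, f x ∂(PortGadget.pathLaw plusLattice
              (plusFugacity (Real.sqrt SAW.criticalFugacity)) (PortGadget.embed plusPos)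
              (PortGadget.inFaces (meshFaces rightAngles D.carrier δ)) δ
              (Sum.inl (a' δ)) (Sum.inl (b' δ)))) -
            ∫ γ, f (γ.curve rightAngles δ) ∂(ybLaw rightAngles D.carrier δ 1 (a' δ) (b' δ)))
          (𝓝[>] (0 : ℝ)) (𝓝 0)) →
    SAWTrackTransport.YBtoUniform :=
  fun hT hZ hK => ybToUniform_of_tight_of_lip hT
    (lipYBtoUniform_of_stubs (lipPlusPointIsZ2_iff.2 hZ) (lipPlusToYB_iff.2 hK))

/-- **The skeleton closes the crux modulo its stubs** (depends on `sorryAx` only through the three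
`stub_*` theorems). -/
theorem YBtoUniform_closed : SAWTrackTransport.YBtoUniform :=
  YBtoUniform_of stub_tightZ2 stub_lipPlusPointIsZ2 stub_lipPlusToYB

/-! ### Cross-references (sorry-free; not stubs): given T, this crux and the sibling crux
`SAWCompassLattice.SurfaceUniversality` (stmt-6964) are ONE problem -/

/-- **Port coupling at bounded-Lipschitz level, as an inequality** (verbatim
`TightToll.norm_integral_yb_sub_compass_le`): for a solution of the compass equations, any domain
`Ω`, mesh `δ`, ports `a, b` and a bounded `L`-Lipschitz `f`,
`‖∫ f (γ.curve) d ybLaw(π/2) Ω δ 1 a b − ∫ f d compassLaw α β s z Ω δ a b‖ ≤ L · |δ|` — both laws are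
push-forwards of ONE normalised compass path measure along two drawings at distance `≤ |δ|`
(landed `PortTransfer.ybLaw_eq_map`, `PortTransfer.compassLaw_eq_map`,
`PortTransfer.dist_compassCurve_curve_le`, `Sketch.stub_portDictionary`). [folklore] -/
theorem norm_integral_yb_sub_compass_le {α β s z : ℝ} (hsol : IsCompassSolution α β s z)
    (Ω : Set ℂ) (δ : ℝ) (a b : MidEdge) (f : CurveClass ℂ →ᵇ ℝ) {L : ℝ≥0}
    (hf : LipschitzWith L f) :
    ‖(∫ γ, f (γ.curve rightAngles δ) ∂(ybLaw rightAngles Ω δ 1 a b)) -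
        ∫ x, f x ∂(SAW.compassLaw α β s z Ω δ a b)‖ ≤ L * |δ| := by
  have hP : SAWCompassLattice.PortDictionary :=
    Summit.CriticalPhenomena.SAWScalingLimit.Cruxes.HexTransfer.Sketch.stub_portDictionary
  have h1 : ∫ γ, f (γ.curve rightAngles δ) ∂(ybLaw rightAngles Ω δ 1 a b) =
      ∫ p, f ((PortTransfer.toYB hP hsol p).curve rightAngles δ)
        ∂(PortTransfer.compassRho α β s z Ω δ a b) := by
    change ∫ γ, f (γ.curve (fun (_ : ℤ) => Real.pi / 2) δ)
        ∂(ybLaw (fun (_ : ℤ) => Real.pi / 2) Ω δ 1 a b) = _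
    rw [PortTransfer.ybLaw_eq_map hP hsol,
      integral_map (PortTransfer.measurable_cpath _).aemeasurable]
    exact (YBWalk.measurable_of_top _).aestronglyMeasurable
  have h2 : ∫ x, f x ∂(SAW.compassLaw α β s z Ω δ a b) =
      ∫ p, f (PortTransfer.compassCurve δ p) ∂(PortTransfer.compassRho α β s z Ω δ a b) := by
    change ∫ x, f x ∂(PortTransfer.compassLaw α β s z Ω δ a b) = _
    rw [PortTransfer.compassLaw_eq_map,
      integral_map (PortTransfer.measurable_cpath _).aemeasurable f.continuous.aestronglyMeasurable]
  rw [h1, h2, ← norm_neg, neg_sub]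
  have key := PortTransfer.norm_integral_sub_integral_le (ε := |δ|)
    (PortTransfer.compassRho_zero_or_prob α β s z Ω δ a b)
    (PortTransfer.measurable_cpath _).aemeasurable (PortTransfer.measurable_cpath _).aemeasurable f hf
    (fun p => PortTransfer.dist_compassCurve_curve_le p (PortTransfer.toYB hP hsol p)
      (PortTransfer.toYB_mids hP hsol p))
  rwa [abs_abs] at key

/-- **The proved leg along `δ → 0⁺`** (verbatim `TightToll.lipPortCoupling`): GM's critical
square-tiling law and the compass chordal law merge on bounded Lipschitz test functions, for every
solution of the compass equations, every domain and every family of ports. [folklore] -/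
theorem lipPortCoupling {α β s z : ℝ} (hsol : IsCompassSolution α β s z) (Ω : Set ℂ)
    (a b : ℝ → MidEdge) (f : CurveClass ℂ →ᵇ ℝ) {L : ℝ≥0} (hf : LipschitzWith L f) :
    Tendsto (fun δ : ℝ => (∫ γ, f (γ.curve rightAngles δ) ∂(ybLaw rightAngles Ω δ 1 (a δ) (b δ))) -
        ∫ x, f x ∂(SAW.compassLaw α β s z Ω δ (a δ) (b δ))) (𝓝[>] (0 : ℝ)) (𝓝 0) := by
  have hε : Tendsto (fun δ : ℝ => (L : ℝ) * |δ|) (𝓝[>] (0 : ℝ)) (𝓝 0) := by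
    have h0 : Tendsto (fun δ : ℝ => |δ|) (𝓝[>] (0 : ℝ)) (𝓝 0) :=
      (continuous_abs.tendsto' (0 : ℝ) 0 abs_zero).mono_left nhdsWithin_le_nhds
    simpa using (tendsto_const_nhds (x := (L : ℝ))).mul h0
  exact squeeze_zero_norm (fun δ => norm_integral_yb_sub_compass_le hsol Ω δ (a δ) (b δ) f hf) hε

/-- **6964 ⇒ Lip-16966**: the sibling crux `SAWCompassLattice.SurfaceUniversality` (stmt-6964),
restricted to bounded Lipschitz functions and composed with the proved port coupling, gives
`LipYBtoUniform` (a compass solution exists by the landed `Sketch.stub_compassRealisation`). [folklore] -/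
theorem lipYBtoUniform_of_surfaceUniversality (hS : SAWCompassLattice.SurfaceUniversality) :
    LipYBtoUniform := by
  intro D a b a' b' hab hab' f L hf
  obtain ⟨α, β, s, z, hsol⟩ :=
    Summit.CriticalPhenomena.SAWScalingLimit.Cruxes.HexTransfer.Sketch.stub_compassRealisation
  have hsol' : IsCompassSolution α β s z := (isCompassSolution_iff α β s z).2 hsol
  have h1 := (Surface.surfaceUniversality_iff.1 hS) α β s z hsol' D a b a' b' hab hab' f
  have h2 := lipPortCoupling hsol' D.carrier a' b' f hf
  have h := h1.sub h2
  rw [sub_zero] at h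
  exact h.congr fun δ => by ring

/-- **1881 ∧ 6964 ⇒ 16966**: given eventual `ℤ²` tightness, the sibling crux `SurfaceUniversality`
implies this crux. Together with the sibling workfile's `TightToll.surfaceUniversality_of_tight_of_ybToUniform :
EventualTight → YBtoUniform → SurfaceUniversality`, the two cruxes are EQUIVALENT given stmt-1881:
staff once. [folklore] -/
theorem ybToUniform_of_tight_of_surfaceUniversality (hT : SAWParafermion.EventualTight)
    (hS : SAWCompassLattice.SurfaceUniversality) : SAWTrackTransport.YBtoUniform :=
  ybToUniform_of_tight_of_lip hT (lipYBtoUniform_of_surfaceUniversality hS)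

end Summit.CriticalPhenomena.SAWScalingLimit.Cruxes.YBtoUniform.Birth

end
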